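import Mathlib

/-!
# Predecessor cells on the pair-carry staircase (stub `stub_staircasePred`)

The stub `stub_staircasePred` of the crux `MobiusLadder.QuadraticDigitPhases`
(stmt-QuantumAdvantage-1391), line `Sketch`.  Mathlib only.

For distinct primes `p ≠ q` the reachable carry states ("cells") of the pair-carry chain of
`T ↦ (pT, qT)` are the pairs `(r, r') ∈ [0,p) × [0,q)` with `r q < (r'+1) p` and `r' p < (r+1) q`
(the real intervals `[r/p,(r+1)/p)` and `[r'/q,(r'+1)/q)` meet).  Every cell other than `(0,0)` has
the cell `(r-1, r')` or `(r, r'-1)` below it: if `r = 0` (resp. `r' = 0`) this is immediate, and if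
`r, r' > 0` then `r q ≠ r' p` (else `p ∣ r q` with `p` coprime to `q`, so `p ∣ r`, impossible for
`0 < r < p`), and `r' p < r q` (resp. `r q < r' p`) gives the cell `(r-1, r')` (resp. `(r, r'-1)`).
-/

set_option linter.dupNamespace false -- D-0017: single-problem summit ⇒ `QuantumAdvantage.QuantumAdvantage` by design

namespace Summit.QuantumAdvantage.QuantumAdvantage.Theorems.MobiusLadderQuadraticDigitPhasesStubStaircasePred

/-- For distinct primes `p ≠ q` and `0 < r < p`, the products `r q` and `r' p` never coincide. -/
theorem mul_ne_mul_of_pos_of_lt {p q r r' : ℕ} (hp : p.Prime) (hq : q.Prime) (hne : p ≠ q)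
    (hr0 : 0 < r) (hr : r < p) : r * q ≠ r' * p := by
  intro heq
  have hdvd : p ∣ r * q := by
    rw [heq]
    exact dvd_mul_left p r'
  have hpr : p ∣ r := ((Nat.coprime_primes hp hq).mpr hne).dvd_of_dvd_mul_right hdvd
  exact absurd (Nat.eq_zero_of_dvd_of_lt hpr hr) hr0.ne'

/-- STAIRCASE PREDECESSOR (stub `stub_staircasePred` of the crux, line `Sketch`): every cell
`(r, r') ≠ (0, 0)` of the pair-carry chain (`r < p`, `r' < q`, `r q < (r'+1) p`, `r' p < (r+1) q`)
has the cell `(r-1, r')` or the cell `(r, r'-1)` as a predecessor; the conjuncts are exactly the cell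
inequalities of those pairs. -/
theorem stub_staircasePred :
    ∀ p q : ℕ, p.Prime → q.Prime → p ≠ q → 2 < p → 2 < q →
      ∀ r r' : ℕ, r < p → r' < q → r * q < (r' + 1) * p → r' * p < (r + 1) * q → (r, r') ≠ (0, 0) →
        (0 < r ∧ (r - 1) * q < (r' + 1) * p ∧ r' * p < r * q) ∨
        (0 < r' ∧ r * q < r' * p ∧ (r' - 1) * p < (r + 1) * q) := by
  intro p q hp hq hne _ _ r r' hr _ h1 h2 h0
  have hsub1 : (r - 1) * q ≤ r * q := Nat.mul_le_mul_right q (Nat.sub_le r 1)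
  have hsub2 : (r' - 1) * p ≤ r' * p := Nat.mul_le_mul_right p (Nat.sub_le r' 1)
  rcases Nat.eq_zero_or_pos r with rfl | hr0
  · -- `r = 0`, hence `r' ≠ 0`: the predecessor is `(0, r'-1)`
    have hr'0 : 0 < r' := by
      rcases Nat.eq_zero_or_pos r' with rfl | h
      · exact absurd rfl h0
      · exact h
    refine Or.inr ⟨hr'0, ?_, lt_of_le_of_lt hsub2 h2⟩
    rw [zero_mul]
    exact Nat.mul_pos hr'0 hp.pos
  · rcases Nat.eq_zero_or_pos r' with rfl | hr'0
    · -- `r > 0`, `r' = 0`: the predecessor is `(r-1, 0)`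
      refine Or.inl ⟨hr0, lt_of_le_of_lt hsub1 h1, ?_⟩
      rw [zero_mul]
      exact Nat.mul_pos hr0 hq.pos
    · -- `r, r' > 0`: `r q ≠ r' p`, and the order of the two products decides
      rcases Nat.lt_trichotomy (r * q) (r' * p) with hlt | heq | hgt
      · exact Or.inr ⟨hr'0, hlt, lt_of_le_of_lt hsub2 h2⟩
      · exact absurd heq (mul_ne_mul_of_pos_of_lt hp hq hne hr0 hr)
      · exact Or.inl ⟨hr0, lt_of_le_of_lt hsub1 h1, hgt⟩

end Summit.QuantumAdvantage.QuantumAdvantage.Theorems.MobiusLadderQuadraticDigitPhasesStubStaircasePred
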